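import Summits.ABC.IUTFork.Cor312LicenceTripleUnconditionalSlotLevel
import Summits.ABC.IUTFork.Conditional.WRowHexLamSevenSevenAllLevels
import HarnessLib

/-!
# R-W WINDOW-TABLE «W:HEX-INHABITED-BANDS» / «W:HEX-7-41-TIE» — the LAST HEX class `(k, l) = (7, 41)`: S_H INHABITED at every genuine Θ-volume datum
# over `(ratPoint λ_7, 41)`, `λ_7 = 1/2 + 2/7⁷`, unconditionally — via the LEVEL-CHOICE socket at the cyclotomic ties over `p = 1231`

PROOF-ONLY file (D-0012; 0 definitions, 0 `Prop` facts) of the abc-iut cell — D-0079 RESCUE sub-cell R-W «WINDOW Θ-SIDE INEQUALITY», prover seat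
abc-iut-w5-d107 (gen 9); closes GAP-LEDGER G-w5d107-g9-1 (abc-iut-plan C-R85 (b)). The band `WRow.licence_lamSeven_seven_all` (p492982) carries
`(h41 : l ≠ 41)` because at the side prime `1231 ∣ 7⁷ − 4` and level `l = 41 ∣ 1230 = 1231 − 1` the admissible ramification indices `e = 615·n` are
TIES `e = (n/2)·1231⁰·(1231 − 1)` of level `n/2` for every even `n`, where abc-iut-w4-d094's level-one outer member (side condition `e ≠ p^c(p−1)`) is
unavailable. Here the socket is this seat's LEVEL-CHOICE variant `WRow.licence_triple_unconditional_slot_level` (`Cor312LicenceTripleUnconditionalSlotLevel`;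
structure verbatim abc-iut-W-row-1's slot socket, outer member `log_p(1 + ϖ^s)` of a level `s` chosen per prime and per index): at `p = 1231` the level
is `s = 1` unless `e = 1231^c·1230`, and then `s = 2` (`WRow.ne_two_mul_pow_mul_sub_one_of_eq`: `1231^c = 2·1231^d` is impossible); at `3, 7, 223, 823547`
the level is `1` (the auxiliary prime `5` divides `e` and not `2·3^c`, `6·7^c`, `222·223^c`, `823546·823547^c`). The cells (`l = 41`, labels `j ≤ 20`,
`e = 1230·n` at `3, 7`, `615·n` at `223, 1231, 823547`; `A_7 = 3`, `A = 0` elsewhere) hold FLOOR-FREE at every `n ≥ 1` with margins ≥ 600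
(desk: HOME/staging/W/w5-d107/gen9/), so each is `e·⌊X/e⌋ ≤ X` plus a linear inequality per label (`interval_cases i`, `omega`). With this file the
INHABITED side of the HEX family is complete: `k ≤ 7` at EVERY prime `l ≥ 11`, `k = 8` at every prime `l ≥ 73` (p493326), and the beyond-table
bands `k = 9` (`l ≥ 347`, p494635), `k = 11` (`l ≥ 821`, p494766). TAKES NO SIDE on [IUTchIII] Cor. 3.12 (S. Mochizuki, *Inter-universal Teichmüller
theory III*, Cor. 3.12 p. 173–174; Step (xi-f) p. 184) or on any author; «inhabited as typed» ≠ «asserted in print».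

WHAT IS PROVED (namespace `Summit.ABC.IUTFork.Conditional`): `WRow.hcell_lamSeven_seven_fortyOne` (the arithmetic with the level choice),
**`WRow.licence_lamSeven_seven_fortyOne`** — for `k = 7`, `l = 41`, EVERY genuine Θ-volume datum `T` at `(ratPoint (1/2 + 2/7^k), 41)` and EVERY pair
of realising Θ- and q-ideles, abc-iut-c312-1's `Thm311ToCor312.Licence` HOLDS at `settingPrVolSharp (pilotDataOfK T.D T.K) …`;
**`WRow.exists_qPinned_and_hull_lamSeven_seven_fortyOne`** — branch C's «∃ ρ qK, QPinned ∧ PilotKummerCompatHull» there, any columns. Admissibility /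
(P6) / Szpiro-badness / NON-EMPTINESS of `(ratPoint λ_7, 41)` NOT claimed. HONEST SCOPE: OUR sharp containers; STRONGER-THAN-PRINT hull reading; nothing
about the printed inequality or any author's intended hull; typed ≠ proved; instantiated ≠ endorsed; no abc claim.
[cite: Mochizuki2012, IUTchI Def. 3.1 (b),(c) pp. 61–62, Rmk. 3.1.5 p. 65, Ex. 3.2 (iv) p. 71; IUTchIII Cor. 3.12 Step (xi-f) p. 184; IUTchIV Prop. 1.1 p. 9, Prop. 1.2 (i)(ii) p. 10, Prop. 1.4 (ii) p. 13, Cor. 2.2 (ii) proof (P5) p. 46]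
[cite: DupuyHilado2025, §3.3, §3.4, §4.9, §4.12] [cite: NeukirchANT1999, Ch. II (5.5)–(5.7)] [claim: Mochizuki2012, status: disputed] for every IUT sentence.
-/

noncomputable section

open Set Function Metric NumberField IsDedekindDomain

namespace Summit.ABC.IUTFork.Conditional

open Thm311 Thm311.Real Cor312 Cor312Vol Cor312Prov Literature.IUT.LogThetaLattice Literature.IUT.LogVolume
  Literature.IUT.HodgeTheaters Literature.IUT.LogVolume.Cor22
open Literature.NumberTheory.NumberFields Literature.NumberTheory.GaloisRepresentations.Ultrametric
open Literature.NumberTheory.DiophantineGeometry Literature.NumberTheory.DiophantineGeometry.GenEll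

/-! ## A floor-free sufficient condition for one cell -/

/-- `e·⌊X/e⌋ + R ≤ P` follows from the floor-free `X + R ≤ P` (`e > 0`). [folklore] -/
private theorem cell_of_floorfree {e X R P : ℤ} (he : 0 < e) (h : X + R ≤ P) : e * (X / e) + R ≤ P := by
  have := Int.mul_ediv_self_le (x := X) he.ne'
  linarith

/-! ## The cells at `l = 41`, one lemma per bad prime (and per level at `1231`) -/

/-- The exact cell at `p = 3`, `l = 41`, `e = 1230·n`, level `s = 1`, exponents `0`/`1`: floor dropped, then linear in `n` at each of the 20 labels. [folklore] -/
private theorem cell41_three {n : ℕ} (hn : 1 ≤ n) {i : ℕ} (hi : i < (41 - 1) / 2) :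
    ((1230 * n : ℕ) : ℤ) * ((((i + 1 : ℕ) : ℤ) ^ 2 * ((1230 * n * (2 * 1) / (2 * 41) : ℕ) : ℤ) -
        ((i + 1 : ℕ) : ℤ) * ((((2 * (1230 * n) - 1 : ℕ) : ℕ)) : ℤ) -
        ((i + 2 : ℕ) : ℤ) * ((((max 1 (1230 * n / (3 - 1))) : ℕ) : ℤ))) / ((1230 * n : ℕ) : ℤ)) +
      ((i + 2 : ℕ) : ℤ) * min (((1 : ℕ) : ℤ) * ((3 : ℕ) : ℤ) ^ 0 - ((0 : ℕ) : ℤ) * ((1230 * n : ℕ) : ℤ))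
        (((1 : ℕ) : ℤ) * ((3 : ℕ) : ℤ) ^ 1 - ((1 : ℕ) : ℤ) * ((1230 * n : ℕ) : ℤ)) ≤
      ((1230 * n * (2 * 1) / (2 * 41) : ℕ) : ℤ) := by
  have hP : 1230 * n * (2 * 1) / (2 * 41) = 30 * n := by omega
  have hR : max 1 (1230 * n / (3 - 1)) = 615 * n := by rw [max_eq_right (by omega)]; omega
  rw [hP, hR, Nat.cast_sub (by omega : 1 ≤ 2 * (1230 * n))]
  refine cell_of_floorfree (by positivity) ?_
  have hm := min_le_right (((1 : ℕ) : ℤ) * ((3 : ℕ) : ℤ) ^ 0 - ((0 : ℕ) : ℤ) * ((1230 * n : ℕ) : ℤ)) (((1 : ℕ) : ℤ) * ((3 : ℕ) : ℤ) ^ 1 - ((1 : ℕ) : ℤ) * ((1230 * n : ℕ) : ℤ))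
  norm_num at hi
  interval_cases i <;> push_cast at hm ⊢ <;> nlinarith [hm, hn]

/-- The exact cell at `p = 7`, `l = 41`, `e = 1230·n`, level `s = 1`, exponents `3`/`4`: floor dropped, then linear in `n` at each of the 20 labels. [folklore] -/
private theorem cell41_seven {n : ℕ} (hn : 1 ≤ n) {i : ℕ} (hi : i < (41 - 1) / 2) :
    ((1230 * n : ℕ) : ℤ) * ((((i + 1 : ℕ) : ℤ) ^ 2 * ((1230 * n * (2 * 7) / (2 * 41) : ℕ) : ℤ) -
        ((i + 1 : ℕ) : ℤ) * ((((1230 * n - 1 : ℕ) : ℕ)) : ℤ) -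
        ((i + 2 : ℕ) : ℤ) * ((((max 1 (1230 * n / (7 - 1))) : ℕ) : ℤ))) / ((1230 * n : ℕ) : ℤ)) +
      ((i + 2 : ℕ) : ℤ) * min (((1 : ℕ) : ℤ) * ((7 : ℕ) : ℤ) ^ 3 - ((3 : ℕ) : ℤ) * ((1230 * n : ℕ) : ℤ))
        (((1 : ℕ) : ℤ) * ((7 : ℕ) : ℤ) ^ 4 - ((4 : ℕ) : ℤ) * ((1230 * n : ℕ) : ℤ)) ≤
      ((1230 * n * (2 * 7) / (2 * 41) : ℕ) : ℤ) := by
  have hP : 1230 * n * (2 * 7) / (2 * 41) = 210 * n := by omega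
  have hR : max 1 (1230 * n / (7 - 1)) = 205 * n := by rw [max_eq_right (by omega)]; omega
  rw [hP, hR, Nat.cast_sub (by omega : 1 ≤ 1230 * n)]
  refine cell_of_floorfree (by positivity) ?_
  have hm := min_le_left (((1 : ℕ) : ℤ) * ((7 : ℕ) : ℤ) ^ 3 - ((3 : ℕ) : ℤ) * ((1230 * n : ℕ) : ℤ)) (((1 : ℕ) : ℤ) * ((7 : ℕ) : ℤ) ^ 4 - ((4 : ℕ) : ℤ) * ((1230 * n : ℕ) : ℤ))
  norm_num at hi
  interval_cases i <;> push_cast at hm ⊢ <;> nlinarith [hm, hn]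

/-- The exact cell at `p = 223`, `l = 41`, `e = 615·n`, level `s = 1`, exponents `0`/`1`: floor dropped, then linear in `n` at each of the 20 labels. [folklore] -/
private theorem cell41_p223 {n : ℕ} (hn : 1 ≤ n) {i : ℕ} (hi : i < (41 - 1) / 2) :
    ((615 * n : ℕ) : ℤ) * ((((i + 1 : ℕ) : ℤ) ^ 2 * ((615 * n * (2 * 1) / (2 * 41) : ℕ) : ℤ) -
        ((i + 1 : ℕ) : ℤ) * ((((615 * n - 1 : ℕ) : ℕ)) : ℤ) -
        ((i + 2 : ℕ) : ℤ) * ((((max 1 (615 * n / (223 - 1))) : ℕ) : ℤ))) / ((615 * n : ℕ) : ℤ)) +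
      ((i + 2 : ℕ) : ℤ) * min (((1 : ℕ) : ℤ) * ((223 : ℕ) : ℤ) ^ 0 - ((0 : ℕ) : ℤ) * ((615 * n : ℕ) : ℤ))
        (((1 : ℕ) : ℤ) * ((223 : ℕ) : ℤ) ^ 1 - ((1 : ℕ) : ℤ) * ((615 * n : ℕ) : ℤ)) ≤
      ((615 * n * (2 * 1) / (2 * 41) : ℕ) : ℤ) := by
  have hP : 615 * n * (2 * 1) / (2 * 41) = 15 * n := by omega
  obtain ⟨M, hMdef, hM1⟩ : ∃ M : ℕ, max 1 (615 * n / (223 - 1)) = M ∧ 1 ≤ M := ⟨_, rfl, le_max_left _ _⟩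
  have hR' : (1 : ℤ) ≤ (M : ℤ) := by exact_mod_cast hM1
  rw [hP, hMdef, Nat.cast_sub (by omega : 1 ≤ 615 * n)]
  refine cell_of_floorfree (by positivity) ?_
  have hm := min_le_left (((1 : ℕ) : ℤ) * ((223 : ℕ) : ℤ) ^ 0 - ((0 : ℕ) : ℤ) * ((615 * n : ℕ) : ℤ)) (((1 : ℕ) : ℤ) * ((223 : ℕ) : ℤ) ^ 1 - ((1 : ℕ) : ℤ) * ((615 * n : ℕ) : ℤ))
  norm_num at hi
  interval_cases i <;> push_cast at hm ⊢ <;> nlinarith [hm, hn, hR']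

/-- The exact cell at `p = 1231`, `l = 41`, `e = 615·n`, level `s = 1`, exponents `0`/`1`: floor dropped, then linear in `n` at each of the 20 labels. [folklore] -/
private theorem cell41_p1231_one {n : ℕ} (hn : 1 ≤ n) {i : ℕ} (hi : i < (41 - 1) / 2) :
    ((615 * n : ℕ) : ℤ) * ((((i + 1 : ℕ) : ℤ) ^ 2 * ((615 * n * (2 * 1) / (2 * 41) : ℕ) : ℤ) -
        ((i + 1 : ℕ) : ℤ) * ((((615 * n - 1 : ℕ) : ℕ)) : ℤ) -
        ((i + 2 : ℕ) : ℤ) * ((((max 1 (615 * n / (1231 - 1))) : ℕ) : ℤ))) / ((615 * n : ℕ) : ℤ)) +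
      ((i + 2 : ℕ) : ℤ) * min (((1 : ℕ) : ℤ) * ((1231 : ℕ) : ℤ) ^ 0 - ((0 : ℕ) : ℤ) * ((615 * n : ℕ) : ℤ))
        (((1 : ℕ) : ℤ) * ((1231 : ℕ) : ℤ) ^ 1 - ((1 : ℕ) : ℤ) * ((615 * n : ℕ) : ℤ)) ≤
      ((615 * n * (2 * 1) / (2 * 41) : ℕ) : ℤ) := by
  have hP : 615 * n * (2 * 1) / (2 * 41) = 15 * n := by omega
  obtain ⟨M, hMdef, hM1⟩ : ∃ M : ℕ, max 1 (615 * n / (1231 - 1)) = M ∧ 1 ≤ M := ⟨_, rfl, le_max_left _ _⟩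
  have hR' : (1 : ℤ) ≤ (M : ℤ) := by exact_mod_cast hM1
  rw [hP, hMdef, Nat.cast_sub (by omega : 1 ≤ 615 * n)]
  refine cell_of_floorfree (by positivity) ?_
  have hm := min_le_left (((1 : ℕ) : ℤ) * ((1231 : ℕ) : ℤ) ^ 0 - ((0 : ℕ) : ℤ) * ((615 * n : ℕ) : ℤ)) (((1 : ℕ) : ℤ) * ((1231 : ℕ) : ℤ) ^ 1 - ((1 : ℕ) : ℤ) * ((615 * n : ℕ) : ℤ))
  norm_num at hi
  interval_cases i <;> push_cast at hm ⊢ <;> nlinarith [hm, hn, hR']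

/-- The exact cell at `p = 1231`, `l = 41`, `e = 615·n`, level `s = 2`, exponents `0`/`1`: floor dropped, then linear in `n` at each of the 20 labels. [folklore] -/
private theorem cell41_p1231_two {n : ℕ} (hn : 1 ≤ n) {i : ℕ} (hi : i < (41 - 1) / 2) :
    ((615 * n : ℕ) : ℤ) * ((((i + 1 : ℕ) : ℤ) ^ 2 * ((615 * n * (2 * 1) / (2 * 41) : ℕ) : ℤ) -
        ((i + 1 : ℕ) : ℤ) * ((((615 * n - 1 : ℕ) : ℕ)) : ℤ) -
        ((i + 2 : ℕ) : ℤ) * ((((max 1 (615 * n / (1231 - 1))) : ℕ) : ℤ))) / ((615 * n : ℕ) : ℤ)) +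
      ((i + 2 : ℕ) : ℤ) * min (((2 : ℕ) : ℤ) * ((1231 : ℕ) : ℤ) ^ 0 - ((0 : ℕ) : ℤ) * ((615 * n : ℕ) : ℤ))
        (((2 : ℕ) : ℤ) * ((1231 : ℕ) : ℤ) ^ 1 - ((1 : ℕ) : ℤ) * ((615 * n : ℕ) : ℤ)) ≤
      ((615 * n * (2 * 1) / (2 * 41) : ℕ) : ℤ) := by
  have hP : 615 * n * (2 * 1) / (2 * 41) = 15 * n := by omega
  obtain ⟨M, hMdef, hM1⟩ : ∃ M : ℕ, max 1 (615 * n / (1231 - 1)) = M ∧ 1 ≤ M := ⟨_, rfl, le_max_left _ _⟩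
  have hR' : (1 : ℤ) ≤ (M : ℤ) := by exact_mod_cast hM1
  rw [hP, hMdef, Nat.cast_sub (by omega : 1 ≤ 615 * n)]
  refine cell_of_floorfree (by positivity) ?_
  have hm := min_le_left (((2 : ℕ) : ℤ) * ((1231 : ℕ) : ℤ) ^ 0 - ((0 : ℕ) : ℤ) * ((615 * n : ℕ) : ℤ)) (((2 : ℕ) : ℤ) * ((1231 : ℕ) : ℤ) ^ 1 - ((1 : ℕ) : ℤ) * ((615 * n : ℕ) : ℤ))
  norm_num at hi
  interval_cases i <;> push_cast at hm ⊢ <;> nlinarith [hm, hn, hR']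

/-- The exact cell at `p = 823547`, `l = 41`, `e = 615·n`, level `s = 1`, exponents `0`/`1`: floor dropped, then linear in `n` at each of the 20 labels. [folklore] -/
private theorem cell41_big {n : ℕ} (hn : 1 ≤ n) {i : ℕ} (hi : i < (41 - 1) / 2) :
    ((615 * n : ℕ) : ℤ) * ((((i + 1 : ℕ) : ℤ) ^ 2 * ((615 * n * (2 * 1) / (2 * 41) : ℕ) : ℤ) -
        ((i + 1 : ℕ) : ℤ) * ((((615 * n - 1 : ℕ) : ℕ)) : ℤ) -
        ((i + 2 : ℕ) : ℤ) * ((((max 1 (615 * n / (823547 - 1))) : ℕ) : ℤ))) / ((615 * n : ℕ) : ℤ)) +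
      ((i + 2 : ℕ) : ℤ) * min (((1 : ℕ) : ℤ) * ((823547 : ℕ) : ℤ) ^ 0 - ((0 : ℕ) : ℤ) * ((615 * n : ℕ) : ℤ))
        (((1 : ℕ) : ℤ) * ((823547 : ℕ) : ℤ) ^ 1 - ((1 : ℕ) : ℤ) * ((615 * n : ℕ) : ℤ)) ≤
      ((615 * n * (2 * 1) / (2 * 41) : ℕ) : ℤ) := by
  have hP : 615 * n * (2 * 1) / (2 * 41) = 15 * n := by omega
  obtain ⟨M, hMdef, hM1⟩ : ∃ M : ℕ, max 1 (615 * n / (823547 - 1)) = M ∧ 1 ≤ M := ⟨_, rfl, le_max_left _ _⟩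
  have hR' : (1 : ℤ) ≤ (M : ℤ) := by exact_mod_cast hM1
  rw [hP, hMdef, Nat.cast_sub (by omega : 1 ≤ 615 * n)]
  refine cell_of_floorfree (by positivity) ?_
  have hm := min_le_left (((1 : ℕ) : ℤ) * ((823547 : ℕ) : ℤ) ^ 0 - ((0 : ℕ) : ℤ) * ((615 * n : ℕ) : ℤ)) (((1 : ℕ) : ℤ) * ((823547 : ℕ) : ℤ) ^ 1 - ((1 : ℕ) : ℤ) * ((615 * n : ℕ) : ℤ))
  norm_num at hi
  interval_cases i <;> push_cast at hm ⊢ <;> nlinarith [hm, hn, hR']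

/-! ## The arithmetic at `l = 41` with the level choice -/

/-- **The level-choice socket's `hcell` for `(823547, 823539, 1647086)` at `l = 41`.** Per bad prime: `e = 1230·n` (`3`, `7`) / `615·n` (`223`, `1231`,
`823547`); level `s = 1` with the auxiliary prime `5` keeping `e` off `p^c(p−1)`, except over `1231` at the ties `e = 1231^c·1230`, where `s = 2`;
the cells are the lemmas above. [folklore] -/
theorem WRow.hcell_lamSeven_seven_fortyOne :
    ∀ p : ℕ, p.Prime → p ∣ 823547 * 823539 * 1647086 → p ≠ 2 → p ≠ 41 → ∀ e : ℕ, 0 < e → 41 ∣ e →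
      15 * 41 ∣ e * (823547 * 823539 * 1647086).factorization p → (p ∣ 30 → (p - 1) ∣ e) →
      (p ∣ 1647086 → Odd ((823547 * 823539 * 1647086).factorization p) → 30 * 41 ∣ e * (823547 * 823539 * 1647086).factorization p) →
      ∃ s : ℕ, 1 ≤ s ∧ (∀ k : ℕ, (e : ℤ) ≠ (s : ℤ) * (p : ℤ) ^ k * ((p : ℤ) - 1)) ∧
      ∀ i : ℕ, i < (41 - 1) / 2 →
        (e : ℤ) * ((((i + 1 : ℕ) : ℤ) ^ 2 * ((e * (2 * (823547 * 823539 * 1647086).factorization p) / (2 * 41) : ℕ) : ℤ) -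
            ((i + 1 : ℕ) : ℤ) * (((if p ∣ 30 ∧ ¬ p ∣ (823547 * 823539 * 1647086).factorization p then 2 * e - 1 else e - 1 : ℕ) : ℕ) : ℤ) -
            ((i + 2 : ℕ) : ℤ) * ((((max 1 (e / (p - 1))) : ℕ) : ℤ))) / (e : ℤ)) +
          ((i + 2 : ℕ) : ℤ) * min ((s : ℤ) * (p : ℤ) ^ (if p = 7 then 3 else 0) - (((if p = 7 then 3 else 0) : ℕ) : ℤ) * (e : ℤ))
            ((s : ℤ) * (p : ℤ) ^ (if p = 7 then 4 else 1) - (((if p = 7 then 4 else 1) : ℕ) : ℤ) * (e : ℤ)) ≤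
        ((e * (2 * (823547 * 823539 * 1647086).factorization p) / (2 * 41) : ℕ) : ℤ) := by
  intro p hp hpabc h2 hpl e he _hle h15 h30 hodd
  rcases eq_of_prime_dvd_triple_hex7 hp hpabc with rfl | rfl | rfl | rfl | rfl | rfl
  · exact absurd rfl h2
  · -- `p = 3`: `e = 1230·n`, level 1
    rw [factorization_triple_hex7.1] at h15 hodd ⊢
    have hA : 615 ∣ e := by simpa using h15
    have hq : 2 ∣ e := by have := h30 (by norm_num); norm_num at this; exact this
    have he0 : 1230 ∣ e := by
      have := Nat.Coprime.mul_dvd_of_dvd_of_dvd (by norm_num : Nat.Coprime 2 615) hq hA; simpa using this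
    obtain ⟨n, rfl⟩ := he0
    have hn : 1 ≤ n := Nat.pos_of_ne_zero (by rintro rfl; simp at he)
    refine ⟨1, le_rfl, fun k => ?_, fun i hi => ?_⟩
    · rw [Nat.cast_one, one_mul]
      exact WRow.natCast_ne_pow_mul_sub_one (by norm_num : Nat.Prime 5) (by norm_num) (by norm_num) (by norm_num) ⟨246 * n, by ring⟩ k
    · rw [if_pos ⟨by norm_num, by norm_num⟩]
      simp only [show ((3 : ℕ) = 7) = False from eq_false (by decide), ite_false]
      exact cell41_three hn hi
  · -- `p = 7`: `e = 1230·n` (twist), level 1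
    rw [factorization_triple_hex7.2.1] at h15 hodd ⊢
    have hT : 1230 ∣ e := by
      have h := hodd (by norm_num) (by decide)
      exact (by norm_num : Nat.Coprime 1230 7).dvd_of_dvd_mul_right h
    obtain ⟨n, rfl⟩ := hT
    have hn : 1 ≤ n := Nat.pos_of_ne_zero (by rintro rfl; simp at he)
    refine ⟨1, le_rfl, fun k => ?_, fun i hi => ?_⟩
    · rw [Nat.cast_one, one_mul]
      exact WRow.natCast_ne_pow_mul_sub_one (by norm_num : Nat.Prime 5) (by norm_num) (by norm_num) (by norm_num) ⟨246 * n, by ring⟩ k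
    · rw [if_neg (by norm_num : ¬ ((7 : ℕ) ∣ 30 ∧ ¬ (7 : ℕ) ∣ 7))]
      simp only [ite_true]
      exact cell41_seven hn hi
  · -- `p = 223`: `e = 615·n`, level 1
    rw [factorization_triple_hex7.2.2.1] at h15 hodd ⊢
    have hA : 615 ∣ e := by simpa using h15
    obtain ⟨n, rfl⟩ := hA
    have hn : 1 ≤ n := Nat.pos_of_ne_zero (by rintro rfl; simp at he)
    refine ⟨1, le_rfl, fun k => ?_, fun i hi => ?_⟩
    · rw [Nat.cast_one, one_mul]
      exact WRow.natCast_ne_pow_mul_sub_one (by norm_num : Nat.Prime 5) (by norm_num) (by norm_num) (by norm_num) ⟨123 * n, by ring⟩ k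
    · rw [if_neg (by norm_num : ¬ ((223 : ℕ) ∣ 30 ∧ ¬ (223 : ℕ) ∣ 1))]
      simp only [show ((223 : ℕ) = 7) = False from eq_false (by decide), ite_false]
      exact cell41_p223 hn hi
  · -- `p = 1231`: `e = 615·n`; LEVEL CHOICE
    rw [factorization_triple_hex7.2.2.2.1] at h15 hodd ⊢
    have hA : 615 ∣ e := by simpa using h15
    obtain ⟨n, rfl⟩ := hA
    have hn : 1 ≤ n := Nat.pos_of_ne_zero (by rintro rfl; simp at he)
    rw [if_neg (by norm_num : ¬ ((1231 : ℕ) ∣ 30 ∧ ¬ (1231 : ℕ) ∣ 1))]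
    simp only [show ((1231 : ℕ) = 7) = False from eq_false (by decide), ite_false]
    by_cases htie : ∀ k : ℕ, (((615 * n : ℕ)) : ℤ) ≠ ((1231 : ℕ) : ℤ) ^ k * (((1231 : ℕ) : ℤ) - 1)
    · exact ⟨1, le_rfl, fun k => by rw [Nat.cast_one, one_mul]; exact htie k, fun i hi => cell41_p1231_one hn hi⟩
    · push Not at htie
      obtain ⟨c, hc⟩ := htie
      refine ⟨2, by norm_num, fun k => ?_, fun i hi => cell41_p1231_two hn hi⟩
      haveI : Fact (Nat.Prime 1231) := ⟨by norm_num⟩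
      have := WRow.ne_two_mul_pow_mul_sub_one_of_eq 1231 (by norm_num) hc k
      push_cast at this ⊢
      exact this
  · -- `p = 823547`: `e = 615·n`, level 1
    rw [factorization_triple_hex7.2.2.2.2] at h15 hodd ⊢
    have hA : 615 ∣ e := by simpa using h15
    obtain ⟨n, rfl⟩ := hA
    have hn : 1 ≤ n := Nat.pos_of_ne_zero (by rintro rfl; simp at he)
    refine ⟨1, le_rfl, fun k => ?_, fun i hi => ?_⟩
    · rw [Nat.cast_one, one_mul]
      exact WRow.natCast_ne_pow_mul_sub_one (by norm_num : Nat.Prime 5) (by norm_num) (by norm_num) (by norm_num) ⟨123 * n, by ring⟩ k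
    · rw [if_neg (by norm_num : ¬ ((823547 : ℕ) ∣ 30 ∧ ¬ (823547 : ℕ) ∣ 1))]
      simp only [show ((823547 : ℕ) = 7) = False from eq_false (by decide), ite_false]
      exact cell41_big hn hi

/-! ## THE CLASS (7, 41): S_H INHABITED at every genuine datum over `(ratPoint λ_7, 41)` -/

/-- **«W:HEX-7-41-TIE»: `k = 7`, `l = 41`** — every genuine Θ-volume datum `T` at `(ratPoint (1/2 + 2/7^7), 41)` ([IUTchIV] Cor. 2.2 (ii) proof (P7))
and every pair of Θ- and q-ideles realising the pilot divisors of `X := pilotDataOfK T.D T.K`: abc-iut-c312-1's `Thm311ToCor312.Licence` HOLDS at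
abc-iut-c312-7's `settingPrVolSharp X …` — the level-choice socket `WRow.licence_triple_unconditional_slot_level` at `WRow.hcell_lamSeven_seven_fortyOne`,
transported along `lamSeven_eq_hex7`. With `WRow.licence_lamSeven_seven_all` (p492982, every prime `l ≥ 11`, `l ≠ 41`) the class `k = 7` is INHABITED at
EVERY prime `l ≥ 11`. [cite: Mochizuki2012, IUTchI Def. 3.1 (b),(c) pp. 61–62, Rmk. 3.1.5 p. 65, Ex. 3.2 (iv) p. 71; IUTchIII Cor. 3.12 Step (xi-f) p. 184; IUTchIV Prop. 1.1 p. 9, Prop. 1.2 (i)(ii) p. 10, Prop. 1.4 (ii) p. 13, Cor. 2.2 (ii) proof (P5) p. 46] [cite: DupuyHilado2025, §3.3, §3.4, §4.9, §4.12] [claim: Mochizuki2012, status: disputed] -/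
theorem WRow.licence_lamSeven_seven_fortyOne {k l : ℕ} (hk : k = 7) (hl : l = 41) (T : Cor22.ThetaVolumeDatumAt (ratPoint ((2 : ℚ)⁻¹ + 2 / 7 ^ k)) l) :
    letI := T.instFieldF; letI := T.instNumberFieldF; letI := T.instAlgebraF; letI := T.instFieldK
    letI := T.instNumberFieldK; letI := T.instAlgebraK; letI := T.instFieldFbar; letI := T.instAlgebraFbar
    letI := T.instAlgebraKFbar; letI := T.instIsElliptic
    ∀ {logv : PadicLogs T.K} (hlog : LogvAnalytic logv) (M : Type) [Field M] [NumberField M]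
      (archPk : ∀ (j : (thetaIndex (pilotDataOfK T.D T.K)).Label) (vQ : (thetaIndex (pilotDataOfK T.D T.K)).VQ),
        Set ((logShellsDH (pilotDataOfK T.D T.K) logv).Packet j vQ))
      (archSub : ∀ (j : (thetaIndex (pilotDataOfK T.D T.K)).Label) (v : (thetaIndex (pilotDataOfK T.D T.K)).V),
        Set ((logShellsDH (pilotDataOfK T.D T.K) logv).Packet j ((thetaIndex (pilotDataOfK T.D T.K)).over v)))
      (Ψ : ℤ → ∀ v : (thetaIndex (pilotDataOfK T.D T.K)).V, v ∈ (thetaIndex (pilotDataOfK T.D T.K)).Vbad →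
        Set ((logShellsDH (pilotDataOfK T.D T.K) logv).StarPacket v))
      (act : ℤ → ∀ v : (thetaIndex (pilotDataOfK T.D T.K)).V, v ∈ (thetaIndex (pilotDataOfK T.D T.K)).Vbad →
        (logShellsDH (pilotDataOfK T.D T.K) logv).StarPacket v → Module.End ℚ ((logShellsDH (pilotDataOfK T.D T.K) logv).StarPacket v))
      (Mmod : ℤ → ∀ j : (thetaIndex (pilotDataOfK T.D T.K)).LabelStar, Set ((logShellsDH (pilotDataOfK T.D T.K) logv).GlobalPacket j.1))
      (region : ℤ → ∀ j : (thetaIndex (pilotDataOfK T.D T.K)).LabelStar, FinDivisor M → ∀ vQ : (thetaIndex (pilotDataOfK T.D T.K)).VQ,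
        Set ((logShellsDH (pilotDataOfK T.D T.K) logv).Packet j.1 vQ))
      (n : ℤ) {HT : Type} {LogLink : HT → HT → Type} {IsFull : ∀ {s t : HT}, LogLink s t → Prop}
      (lat : LGPGaussianLogThetaLattice LogLink IsFull)
      {Frd : Type} {IsoF : Frd → Frd → Type} {Ob : Frd → Type} {realify : Frd → Frd} {Strip : Type}
      {IsoS : Strip → Strip → Type} {Mv : ∀ v : (thetaIndex (pilotDataOfK T.D T.K)).V, v ∈ (thetaIndex (pilotDataOfK T.D T.K)).Vbad → Type}
      [∀ v h, Monoid (Mv v h)]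
      (sig : GlobalLGPFrobenioidSignature (thetaIndex (pilotDataOfK T.D T.K)).lstar (thetaIndex (pilotDataOfK T.D T.K)).V
        (· ∈ (thetaIndex (pilotDataOfK T.D T.K)).Vbad) Frd IsoF Ob realify Strip IsoS Mv)
      (split : SplittingMonoids Mv) {ObΔ : Type} {N : ∀ v : (thetaIndex (pilotDataOfK T.D T.K)).V, v ∈ (thetaIndex (pilotDataOfK T.D T.K)).Vbad → Type}
      [∀ v h, Monoid (N v h)] (qData : QPilotData ObΔ N)
      (tq : ∀ (pp : Nat.Primes) (x : (thetaIndex (pilotDataOfK T.D T.K)).Fibre (.inr pp)),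
        haveI : Fact (pp : ℕ).Prime := ⟨pp.2⟩; kOf (pilotDataOfK T.D T.K) pp.1 x)
      (t : ∀ (pp : Nat.Primes) (_ : Fin (pilotDataOfK T.D T.K).lstar) (x : (thetaIndex (pilotDataOfK T.D T.K)).Fibre (.inr pp)),
        haveI : Fact (pp : ℕ).Prime := ⟨pp.2⟩; kOf (pilotDataOfK T.D T.K) pp.1 x)
      (htq0 : ∀ pp x, tq pp x ≠ 0)
      (htq1 : ∀ (pp : Nat.Primes) (x : (thetaIndex (pilotDataOfK T.D T.K)).Fibre (.inr pp)),
        haveI : Fact (pp : ℕ).Prime := ⟨pp.2⟩; placeOf (pilotDataOfK T.D T.K) pp.1 x ∉ (pilotDataOfK T.D T.K).S → ‖tq pp x‖ = 1)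
      (_ht0 : ∀ pp i x, t pp i x ≠ 0)
      (_ht : ∀ (pp : Nat.Primes) (i : Fin (pilotDataOfK T.D T.K).lstar) (x : (thetaIndex (pilotDataOfK T.D T.K)).Fibre (.inr pp)),
        haveI : Fact (pp : ℕ).Prime := ⟨pp.2⟩
        Real.log ‖t pp i x‖ = -((pilotDataOfK T.D T.K).thetaPilot i (placeOf (pilotDataOfK T.D T.K) pp.1 x)) *
          logNorm T.K (placeOf (pilotDataOfK T.D T.K) pp.1 x) / localDegree T.K (placeOf (pilotDataOfK T.D T.K) pp.1 x))
      (_htq : ∀ (pp : Nat.Primes) (x : (thetaIndex (pilotDataOfK T.D T.K)).Fibre (.inr pp)),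
        haveI : Fact (pp : ℕ).Prime := ⟨pp.2⟩
        Real.log ‖tq pp x‖ = -((pilotDataOfK T.D T.K).qPilot (placeOf (pilotDataOfK T.D T.K) pp.1 x)) *
          logNorm T.K (placeOf (pilotDataOfK T.D T.K) pp.1 x) / localDegree T.K (placeOf (pilotDataOfK T.D T.K) pp.1 x)),
      Thm311ToCor312.Licence
        (settingPrVolSharp (pilotDataOfK T.D T.K) hlog M archPk archSub Ψ act Mmod region n lat sig split qData tq t htq0 htq1) := by
  subst hk hl
  revert T
  rw [lamSeven_eq_hex7]
  intro T
  exact WRow.licence_triple_unconditional_slot_level isABCTriple_hex7 (by rw [Cor22.jInv_ratPoint_triple isABCTriple_hex7]; norm_num) T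
    (fun p => if p = 7 then 3 else 0) (fun p => if p = 7 then 4 else 1) WRow.hcell_lamSeven_seven_fortyOne

/-- **BRANCH C's PER-DATUM ANTECEDENT «∃ ρ qK, QPinned ∧ PilotKummerCompatHull» at every genuine datum over `(ratPoint (1/2 + 2/7^7), 41)`** (any columns
`col`; every pair of realising Θ- and q-ideles, the CHOSEN ones of the window certificates' `hSHw`/`hSHwBad` binders included): the per-datum S_H object of
the certificates of record (p453137 / p450130 / p447945) HOLDS at this datum class, UNCONDITIONALLY — the last HEX class.
[cite: Mochizuki2012, IUTchIII Cor. 3.12 Step (xi-d) p. 183, (xi-f) p. 184] [cite: DupuyHilado2025, §3.3, §3.4, §4.9] [claim: Mochizuki2012, status: disputed] -/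
theorem WRow.exists_qPinned_and_hull_lamSeven_seven_fortyOne {k l : ℕ} (hk : k = 7) (hl : l = 41)
    (T : Cor22.ThetaVolumeDatumAt (ratPoint ((2 : ℚ)⁻¹ + 2 / 7 ^ k)) l) :
    letI := T.instFieldF; letI := T.instNumberFieldF; letI := T.instAlgebraF; letI := T.instFieldK
    letI := T.instNumberFieldK; letI := T.instAlgebraK; letI := T.instFieldFbar; letI := T.instAlgebraFbar
    letI := T.instAlgebraKFbar; letI := T.instIsElliptic
    ∀ {logv : PadicLogs T.K} (hlog : LogvAnalytic logv) (M : Type) [Field M] [NumberField M]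
      (archPk : ∀ (j : (thetaIndex (pilotDataOfK T.D T.K)).Label) (vQ : (thetaIndex (pilotDataOfK T.D T.K)).VQ),
        Set ((logShellsDH (pilotDataOfK T.D T.K) logv).Packet j vQ))
      (archSub : ∀ (j : (thetaIndex (pilotDataOfK T.D T.K)).Label) (v : (thetaIndex (pilotDataOfK T.D T.K)).V),
        Set ((logShellsDH (pilotDataOfK T.D T.K) logv).Packet j ((thetaIndex (pilotDataOfK T.D T.K)).over v)))
      (Ψ : ℤ → ∀ v : (thetaIndex (pilotDataOfK T.D T.K)).V, v ∈ (thetaIndex (pilotDataOfK T.D T.K)).Vbad →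
        Set ((logShellsDH (pilotDataOfK T.D T.K) logv).StarPacket v))
      (act : ℤ → ∀ v : (thetaIndex (pilotDataOfK T.D T.K)).V, v ∈ (thetaIndex (pilotDataOfK T.D T.K)).Vbad →
        (logShellsDH (pilotDataOfK T.D T.K) logv).StarPacket v → Module.End ℚ ((logShellsDH (pilotDataOfK T.D T.K) logv).StarPacket v))
      (Mmod : ℤ → ∀ j : (thetaIndex (pilotDataOfK T.D T.K)).LabelStar, Set ((logShellsDH (pilotDataOfK T.D T.K) logv).GlobalPacket j.1))
      (region : ℤ → ∀ j : (thetaIndex (pilotDataOfK T.D T.K)).LabelStar, FinDivisor M → ∀ vQ : (thetaIndex (pilotDataOfK T.D T.K)).VQ,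
        Set ((logShellsDH (pilotDataOfK T.D T.K) logv).Packet j.1 vQ))
      (n : ℤ) {HT : Type} {LogLink : HT → HT → Type} {IsFull : ∀ {s t : HT}, LogLink s t → Prop}
      (lat : LGPGaussianLogThetaLattice LogLink IsFull)
      {Frd : Type} {IsoF : Frd → Frd → Type} {Ob : Frd → Type} {realify : Frd → Frd} {Strip : Type}
      {IsoS : Strip → Strip → Type} {Mv : ∀ v : (thetaIndex (pilotDataOfK T.D T.K)).V, v ∈ (thetaIndex (pilotDataOfK T.D T.K)).Vbad → Type}
      [∀ v h, Monoid (Mv v h)]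
      (sig : GlobalLGPFrobenioidSignature (thetaIndex (pilotDataOfK T.D T.K)).lstar (thetaIndex (pilotDataOfK T.D T.K)).V
        (· ∈ (thetaIndex (pilotDataOfK T.D T.K)).Vbad) Frd IsoF Ob realify Strip IsoS Mv)
      (split : SplittingMonoids Mv) {ObΔ : Type} {N : ∀ v : (thetaIndex (pilotDataOfK T.D T.K)).V, v ∈ (thetaIndex (pilotDataOfK T.D T.K)).Vbad → Type}
      [∀ v h, Monoid (N v h)] (qData : QPilotData ObΔ N)
      (tq : ∀ (pp : Nat.Primes) (x : (thetaIndex (pilotDataOfK T.D T.K)).Fibre (.inr pp)),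
        haveI : Fact (pp : ℕ).Prime := ⟨pp.2⟩; kOf (pilotDataOfK T.D T.K) pp.1 x)
      (t : ∀ (pp : Nat.Primes) (_ : Fin (pilotDataOfK T.D T.K).lstar) (x : (thetaIndex (pilotDataOfK T.D T.K)).Fibre (.inr pp)),
        haveI : Fact (pp : ℕ).Prime := ⟨pp.2⟩; kOf (pilotDataOfK T.D T.K) pp.1 x)
      (htq0 : ∀ pp x, tq pp x ≠ 0)
      (htq1 : ∀ (pp : Nat.Primes) (x : (thetaIndex (pilotDataOfK T.D T.K)).Fibre (.inr pp)),
        haveI : Fact (pp : ℕ).Prime := ⟨pp.2⟩; placeOf (pilotDataOfK T.D T.K) pp.1 x ∉ (pilotDataOfK T.D T.K).S → ‖tq pp x‖ = 1)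
      (col : ℤ → Column (logShellsDH (pilotDataOfK T.D T.K) logv))
      (_ht0 : ∀ pp i x, t pp i x ≠ 0)
      (_ht : ∀ (pp : Nat.Primes) (i : Fin (pilotDataOfK T.D T.K).lstar) (x : (thetaIndex (pilotDataOfK T.D T.K)).Fibre (.inr pp)),
        haveI : Fact (pp : ℕ).Prime := ⟨pp.2⟩
        Real.log ‖t pp i x‖ = -((pilotDataOfK T.D T.K).thetaPilot i (placeOf (pilotDataOfK T.D T.K) pp.1 x)) *
          logNorm T.K (placeOf (pilotDataOfK T.D T.K) pp.1 x) / localDegree T.K (placeOf (pilotDataOfK T.D T.K) pp.1 x))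
      (_htq : ∀ (pp : Nat.Primes) (x : (thetaIndex (pilotDataOfK T.D T.K)).Fibre (.inr pp)),
        haveI : Fact (pp : ℕ).Prime := ⟨pp.2⟩
        Real.log ‖tq pp x‖ = -((pilotDataOfK T.D T.K).qPilot (placeOf (pilotDataOfK T.D T.K) pp.1 x)) *
          logNorm T.K (placeOf (pilotDataOfK T.D T.K) pp.1 x) / localDegree T.K (placeOf (pilotDataOfK T.D T.K) pp.1 x)),
      ∃ (ρ : (∀ v : (thetaIndex (pilotDataOfK T.D T.K)).V, v ∈ (thetaIndex (pilotDataOfK T.D T.K)).Vbad →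
              Set ((logShellsDH (pilotDataOfK T.D T.K) logv).StarPacket v)) →
            ∀ (j : (thetaIndex (pilotDataOfK T.D T.K)).Label) (vQ : (thetaIndex (pilotDataOfK T.D T.K)).VQ),
              Set ((logShellsDH (pilotDataOfK T.D T.K) logv).Packet j vQ))
          (qK : ∀ v : (thetaIndex (pilotDataOfK T.D T.K)).V, v ∈ (thetaIndex (pilotDataOfK T.D T.K)).Vbad →
            Set ((logShellsDH (pilotDataOfK T.D T.K) logv).StarPacket v)),
          QPinned ({ toSituation := situationPrVol (pilotDataOfK T.D T.K) hlog M archPk archSub Ψ act Mmod region, col := col } :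
              LatticeSituation (thetaIndex (pilotDataOfK T.D T.K)))
            (settingPrVolSharp (pilotDataOfK T.D T.K) hlog M archPk archSub Ψ act Mmod region n lat sig split qData tq t htq0 htq1) ρ qK ∧
          PilotKummerCompatHull ({ toSituation := situationPrVol (pilotDataOfK T.D T.K) hlog M archPk archSub Ψ act Mmod region, col := col } :
              LatticeSituation (thetaIndex (pilotDataOfK T.D T.K)))
            (settingPrVolSharp (pilotDataOfK T.D T.K) hlog M archPk archSub Ψ act Mmod region n lat sig split qData tq t htq0 htq1) ρ qK := by
  subst hk hl
  revert T
  rw [lamSeven_eq_hex7]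
  intro T
  exact WRow.exists_qPinned_and_hull_triple_unconditional_slot_level isABCTriple_hex7 (by rw [Cor22.jInv_ratPoint_triple isABCTriple_hex7]; norm_num) T
    (fun p => if p = 7 then 3 else 0) (fun p => if p = 7 then 4 else 1) WRow.hcell_lamSeven_seven_fortyOne

end Summit.ABC.IUTFork.Conditional

end
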